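import Literature.MathematicalPhysics.QuantumLattice.HubbardPairDensityCouplingFloor
import Literature.MathematicalPhysics.QuantumLattice.FreeFermiGasPairingCostSharp
import HarnessLib

/-!
# Ground-state `d`-wave pair density of the repulsive Hubbard torus is `O(√U)`

Family `hubbard` / topic `MathematicalPhysics/QuantumLattice`; sharpening of
`HubbardPairDensityCouplingFloor.lean` (there: pair density `c` in a sector ground state at coupling
`U ≥ 0` forces `4(min(c,1)/48)⁶ ≤ U`, i.e. `c ≤ 48 (U/4)^{1/6}`). With the QUADRATIC pairing-cost
rate of `FreeFermiGasPairingCostSharp.lean` the same two-line argument gives: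

* `hubbardTorus_groundState_pairLRO_coupling_floor_sharp`: a normalised ground state `ψ` of
  `hubbardTorus 2 L 1 U` (`U ≥ 0`) in a sector `(2n, S^z = 0)`, `n ≤ L²`, `L ≥ ⌈1216/c⌉ + 3`, with
  `Re ⟨ψ, Δ_d†Δ_d ψ⟩ ≥ c·L⁴` (`c > 0`) forces `(min(c,1)/8192)² ≤ U`;
* `min_pairDensity_one_le_mul_sqrt_coupling`: equivalently `min(c,1) ≤ 8192·√U` — the ground-state
  `d`-wave pair density of the weakly repulsive Hubbard torus is `O(√U)` as `U → 0⁺`, uniformly in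
  the filling and in `L` beyond the finite-size threshold;
* `re_expect_pairField_dWave_lt_of_groundStateInSector_sharp`: for `0 ≤ U < (min(c,1)/8192)²`,
  EVERY normalised sector ground state has `Re ⟨ψ, Δ_d†Δ_d ψ⟩ < c·L⁴`.

Mechanism (unchanged): the interacting ground state has free kinetic energy at most `U·L²` above the
free sector ground energy (`re_expect_hubbardTorus_zero_le_of_groundStateInSector`, variational
principle with `0 ≤ Σ n↑n↓ ≤ L²`), while pair density `c` costs `(min(c,1)/8192)²·L²`
(`freeDWavePairing_costs_energy_sharp_rate`). The exponent `1/2` is the limit of this energy-balance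
method with a first-order (`O(U)·L²`) kinetic budget; a second-order budget `O(U²)·L²` (correlation
energy bounds of Hartree–Fock accuracy type) would give `O(U)`, and the expected truth is
`e^{-O(1/U)}`-small (BCS/Kohn–Luttinger asymptotics) — neither is claimed here.

Sources: Bardeen–Cooper–Schrieffer, Phys. Rev. 108 (1957) 1175, §II; C. N. Yang, Rev. Mod. Phys. 34
(1962) 694, §3; H. Tasaki, Physics and Mathematics of Quantum Many-Body Systems (2020) §2.2
(variational principle). Folklore finite-dimensional statements; no named facts, no definitions.
Tree search: `hubbardTorus_groundState_pairLRO_coupling_floor` (sextic companion),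
`re_expect_hubbardTorus_zero_le_of_groundStateInSector`, `freeDWavePairing_costs_energy_sharp_rate`.
-/

noncomputable section

namespace Literature.MathematicalPhysics.QuantumLattice

open Matrix Finset Literature.Probability.LatticeModels
open scoped ComplexOrder ComplexConjugate

variable {L : ℕ} [NeZero L]

/-- **Sharp coupling floor for `d`-wave pair LRO in a sector ground state.** If a normalised ground
state `ψ` of `hubbardTorus 2 L 1 U` (`U ≥ 0`) in a sector `(2n, S^z = 0)`, `n ≤ L²`,
`L ≥ ⌈1216/c⌉ + 3`, has `Re ⟨ψ, Δ_d†Δ_d ψ⟩ ≥ c·L⁴` (`c > 0`), then `(min(c,1)/8192)² ≤ U`.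
Bardeen–Cooper–Schrieffer (1957) §II; Tasaki (2020) §2.2. [folklore] -/
theorem hubbardTorus_groundState_pairLRO_coupling_floor_sharp {c U : ℝ} (hc : 0 < c) (hU : 0 ≤ U)
    (hL : ⌈1216 / c⌉₊ + 3 ≤ L) {n : ℕ} (hn : n ≤ L ^ 2) {ψ : Fock (Orb (FermionTorus 2 L))}
    (hψ : IsGroundStateInSector (hubbardTorus 2 L 1 U) (2 * n) 0 ψ) (h1 : star ψ ⬝ᵥ ψ = 1)
    (hY : c * (L : ℝ) ^ 4 ≤
      (star ψ ⬝ᵥ (((pairField dWaveFormFactor L)ᴴ * pairField dWaveFormFactor L) *ᵥ ψ)).re) :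
    (min c 1 / 8192) ^ 2 ≤ U := by
  have hcost := freeDWavePairing_costs_energy_sharp_rate hc hL hψ.1 h1 hY
  have hfree := re_expect_hubbardTorus_zero_le_of_groundStateInSector hU hn hψ h1
  have hL2 : (0 : ℝ) < (L : ℝ) ^ 2 := by
    have : (0 : ℝ) < (L : ℝ) := by exact_mod_cast Nat.pos_of_ne_zero (NeZero.ne L)
    positivity
  have hmul : (min c 1 / 8192) ^ 2 * (L : ℝ) ^ 2 ≤ U * (L : ℝ) ^ 2 := by linarith
  exact le_of_mul_le_mul_right hmul hL2

/-- **The ground-state `d`-wave pair density is `O(√U)`.** Under the hypotheses of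
`hubbardTorus_groundState_pairLRO_coupling_floor_sharp`: `min(c,1) ≤ 8192·√U`. In words: a sector
ground state of the repulsive Hubbard torus at coupling `U ≥ 0` (any filling, `L` beyond the
finite-size threshold `⌈1216/c⌉ + 3`) carries `d`-wave pair order `Re⟨Δ_d†Δ_d⟩ ≥ c·L⁴` only if
`c ≤ 8192 √U` or `c ≥ 1`; so for `U < 8192⁻²` the pair density is at most `8192 √U`, while for
larger `U` the statement is void. Bardeen–Cooper–Schrieffer (1957) §II. [folklore] -/
theorem min_pairDensity_one_le_mul_sqrt_coupling {c U : ℝ} (hc : 0 < c) (hU : 0 ≤ U)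
    (hL : ⌈1216 / c⌉₊ + 3 ≤ L) {n : ℕ} (hn : n ≤ L ^ 2) {ψ : Fock (Orb (FermionTorus 2 L))}
    (hψ : IsGroundStateInSector (hubbardTorus 2 L 1 U) (2 * n) 0 ψ) (h1 : star ψ ⬝ᵥ ψ = 1)
    (hY : c * (L : ℝ) ^ 4 ≤
      (star ψ ⬝ᵥ (((pairField dWaveFormFactor L)ᴴ * pairField dWaveFormFactor L) *ᵥ ψ)).re) :
    min c 1 ≤ 8192 * Real.sqrt U := by
  have h := hubbardTorus_groundState_pairLRO_coupling_floor_sharp hc hU hL hn hψ h1 hY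
  have h0 : 0 ≤ min c 1 / 8192 := by
    have := lt_min hc one_pos
    positivity
  have hs := Real.sqrt_le_sqrt h
  rw [Real.sqrt_sq h0] at hs
  linarith

/-- **Weak repulsion carries little `d`-wave pair order (sharp a-priori bound).** For `c > 0`,
`0 ≤ U < (min(c,1)/8192)²`, `L ≥ ⌈1216/c⌉ + 3` and `n ≤ L²`, EVERY normalised ground state `ψ` of
`hubbardTorus 2 L 1 U` in the sector `(2n, S^z = 0)` has `Re ⟨ψ, Δ_d†Δ_d ψ⟩ < c·L⁴`.
Bardeen–Cooper–Schrieffer (1957) §II; Yang (1962) §3. [folklore] -/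
theorem re_expect_pairField_dWave_lt_of_groundStateInSector_sharp {c U : ℝ} (hc : 0 < c)
    (hU0 : 0 ≤ U) (hU : U < (min c 1 / 8192) ^ 2) (hL : ⌈1216 / c⌉₊ + 3 ≤ L) {n : ℕ}
    (hn : n ≤ L ^ 2) {ψ : Fock (Orb (FermionTorus 2 L))}
    (hψ : IsGroundStateInSector (hubbardTorus 2 L 1 U) (2 * n) 0 ψ) (h1 : star ψ ⬝ᵥ ψ = 1) :
    (star ψ ⬝ᵥ (((pairField dWaveFormFactor L)ᴴ * pairField dWaveFormFactor L) *ᵥ ψ)).re <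
      c * (L : ℝ) ^ 4 := by
  by_contra h
  push Not at h
  have := hubbardTorus_groundState_pairLRO_coupling_floor_sharp hc hU0 hL hn hψ h1 h
  linarith

omit [NeZero L] in
/-- A non-zero vector of the sector `(2n, S^z = 0)` of the fermionic torus has `n ≤ L²` (a
supporting configuration has `n` up-spins among `L²` sites). [folklore] -/
theorem le_sq_of_mem_szSector_two_mul_zero {n : ℕ} {ψ : Fock (Orb (FermionTorus 2 L))}
    (hψ : ψ ∈ szSector (Λ := FermionTorus 2 L) (2 * n) 0) (h0 : ψ ≠ 0) : n ≤ L ^ 2 := by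
  have hsec : IsInSector n n ψ := (mem_szSector_two_mul_zero_iff n ψ).1 hψ
  obtain ⟨s, hs⟩ := Function.ne_iff.1 h0
  have hns : (upPart s).card = n := (not_imp_comm.1 (hsec s) hs).1
  rw [← hns]
  calc (upPart s).card ≤ (Finset.univ : Finset (FermionTorus 2 L)).card := Finset.card_le_univ _
    _ = L ^ 2 := by simp

/-- **Ground-state `d`-wave pair density of the repulsive Hubbard torus is eventually below any
`c` with `min(c,1) > 8192·√U`** — uniformly in the filling and in the choice of ground state: for
`U ≥ 0`, `c > 0` with `8192·√U < min(c,1)`, for all sides `L ≥ ⌈1216/c⌉ + 3`, every `N` and every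
normalised ground state `ψ` of `hubbardTorus 2 L 1 U` in the sector `(N, S^z = 0)`:
`Re ⟨ψ, Δ_d†Δ_d ψ⟩ < c·L⁴`. In particular along any sequence of sector ground states
`limsup_L L⁻⁴ Re⟨ψ_L, Δ_d†Δ_d ψ_L⟩ ≤ 8192·√U` whenever `8192 √U < 1`: an explicit a-priori ceiling
on the order parameter of the `HubbardSuperconductivity` summit at its own witness coupling.
Bardeen–Cooper–Schrieffer (1957) §II; Yang (1962) §3. [folklore] -/
theorem hubbardTorus_groundState_pairDensity_lt_of_sqrt_coupling_lt {c U : ℝ} (hc : 0 < c)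
    (hU : 0 ≤ U) (hcU : 8192 * Real.sqrt U < min c 1) (hL : ⌈1216 / c⌉₊ + 3 ≤ L) {N : ℕ}
    {ψ : Fock (Orb (FermionTorus 2 L))}
    (hψ : IsGroundStateInSector (hubbardTorus 2 L 1 U) N 0 ψ) (h1 : star ψ ⬝ᵥ ψ = 1) :
    (star ψ ⬝ᵥ (((pairField dWaveFormFactor L)ᴴ * pairField dWaveFormFactor L) *ᵥ ψ)).re <
      c * (L : ℝ) ^ 4 := by
  have h0 : ψ ≠ 0 := by rintro rfl; simp at h1
  obtain ⟨n, rfl⟩ := exists_eq_two_mul_of_mem_szSector_zero hψ.1 h0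
  have hn := le_sq_of_mem_szSector_two_mul_zero hψ.1 h0
  have hU' : U < (min c 1 / 8192) ^ 2 := by
    have hs0 : 0 ≤ Real.sqrt U := Real.sqrt_nonneg U
    have hlt : Real.sqrt U < min c 1 / 8192 := by linarith
    calc U = Real.sqrt U ^ 2 := (Real.sq_sqrt hU).symm
      _ < (min c 1 / 8192) ^ 2 := by
          exact pow_lt_pow_left₀ hlt hs0 (by norm_num)
  exact re_expect_pairField_dWave_lt_of_groundStateInSector_sharp hc hU hU' hL hn hψ h1

end Literature.MathematicalPhysics.QuantumLattice
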